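import Mathlib
import Literature.Probability.Percolation.IkhlefPonsaingFirstPassageAssembly
import Literature.Probability.Percolation.DiagonalStripVertexEmbeddingInjective
import Literature.Probability.Percolation.DiagonalStripVertexTLGauge
import Literature.Probability.Percolation.DiagonalStripVertexUniqueness
import HarnessLib

/-!
# IP12 Prop. 4.7: the discharge through the vertex representation

Topic `Literature/Probability/Percolation`. This file proves **`IkhlefPonsaingFirstPassage_holds`**.
By `IkhlefPonsaingFirstPassageAssembly` everything reduces to the twist bound `-a ≤ 2m` for the
primitive polynomial loop ground state `P` (`IsGroundState m q P a`), i.e. to the existence of the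
degree-`4m` polynomial solution of IP12's boundary qKZ system — the one input IP12 import from
[DF05]/[dGP07]. We supply it from the spin-chain side (Hagendorf–Liénardy): the vector `Φ` of
`DiagonalStripVertexTLGauge` solves the same exchange/reflection system on the `m`-sector of the
spin chain with `2m+1` sites, with `Π^{2m} Φ` polynomial (`oursVec_laurent`) and trivial twists.
The `q`-singlet embedding `M` (`DiagonalStripVertexEmbedding`) intertwines the loop generators with
the spin-chain ones (`embMc_joinS`, `embMc_isolS`), so `M(P)` solves the vertex system with twist `a`;
by the vertex uniqueness theorem (`vertex_solutions_proportional`) `M(P)` and `Π^{-a} Φ` are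
proportional, and since `M` has a constant left inverse (`exists_leftInverse_embMc`) and `P` is
primitive, `P_Q` divides... more precisely `H_s = B · P_{Q_s}` for polynomials `H_s` of `z_1`-degree
`≤ 4m`, whence `deg_{z_1} P_Q ≤ 4m`, and a component with `P_Q(z_1 = 0) ≠ 0` has `z_1`-degree `-2a`.

## References

* Y. Ikhlef, A. K. Ponsaing, *Finite-size left-passage probability in percolation*, J. Stat. Phys.
  149 (2012) 10–36, arXiv:1202.5476, §3.1, §3.4–3.6, Prop. 4.7. [IkhlefPonsaing2012]
* C. Hagendorf, J. Liénardy, *The open XXZ chain at Δ = -1/2 and the boundary quantum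
  Knizhnik–Zamolodchikov equations*, J. Stat. Mech. (2021) 013104, arXiv:2008.03220, §3. [HagendorfLienardy2021]
-/

noncomputable section

namespace Literature.Probability.Percolation

open Finset MvPolynomial Literature.Probability.LatticeModels Literature.Probability.LatticeModels.TemperleyLieb

variable {m : ℕ} {q : ℂ}

/-! ### Constants as a ring homomorphism -/

/-- The constants `ℂ → ℂ(z)`. [folklore] -/
def cHom : ℂ →+* RapidityField ℂ := (toRF ℂ).comp MvPolynomial.C

/-- `cHom = genC`. [folklore] -/
theorem cHom_apply (x : ℂ) : cHom x = genC ℂ x := rfl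

/-! ### The loop ground state on the connectivity basis -/

section LoopSide

variable (hq : q ^ 2 + q + 1 = 0) {P : ColPattern m → MvPolynomial ℕ ℂ} {a : ℤ}

/-- The loop ground state on non-crossing states: `v_s = P_{Q_s}`. [cite: IkhlefPonsaing2012, §3.4] -/
def gsVec (P : ColPattern m → MvPolynomial ℕ ℂ) (s : NCState (m + 1)) : RapidityField ℂ := toRF ℂ (P (cpOf s))

include hq

/-- The support of the ground state. [cite: IkhlefPonsaing2012, §3.4] -/
theorem gs_support (h : IsGroundState m q P a) :
    ∀ Q, (fun Q => toRF ℂ (P Q)) Q ≠ 0 → IsValid 0 Q ∧ IsPlanar Q ∧ lump Q = Q :=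
  fun _ hQ => groundState_support hq h.fixed hQ

/-- **The odd exchange relation on the connectivity basis** (join of `j', j'+1`, level `2j'+1`).
[cite: IkhlefPonsaing2012, §3.4 (20)] -/
theorem gsVec_exchange_join (h : IsGroundState m q P a) (j' : Fin m) (s : NCState (m + 1)) :
    qbr (genC ℂ q * genZ ℂ (2 * (j' : ℕ) + 1 + 1) / genZ ℂ (2 * (j' : ℕ) + 1)) * gsVec P s -
        qbr (genZ ℂ (2 * (j' : ℕ) + 1) / genZ ℂ (2 * (j' : ℕ) + 1 + 1)) *
          ∑ s₀ ∈ univ.filter (fun s₀ => NCState.joinS (Fin.castSucc j') j'.succ (by simp) s₀ = s), gsVec P s₀ =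
      qbr (genC ℂ q * genZ ℂ (2 * (j' : ℕ) + 1) / genZ ℂ (2 * (j' : ℕ) + 1 + 1)) * genSwap ℂ (2 * (j' : ℕ) + 1) (gsVec P s) := by
  have hex := h.odd j' (cpOf s)
  have hfib : ipPush (cpJoin (Fin.castSucc j') j'.succ) (fun Q => toRF ℂ (P Q)) (cpOf s) =
      ∑ s₀ ∈ univ.filter (fun s₀ => NCState.joinS (Fin.castSucc j') j'.succ (by simp) s₀ = s), gsVec P s₀ :=
    sum_fiber_cpJoin_eq (gs_support hq h) _ _ (by simp) s
  rw [hfib] at hex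
  exact hex

/-- **The even exchange relation on the connectivity basis** (isolation of `b0+1`, level `2b0+2`).
[cite: IkhlefPonsaing2012, §3.4 (20)] -/
theorem gsVec_exchange_isol (h : IsGroundState m q P a) (b0 : Fin m) (s : NCState (m + 1)) :
    qbr (genC ℂ q * genZ ℂ (2 * (b0 : ℕ) + 2 + 1) / genZ ℂ (2 * (b0 : ℕ) + 2)) * gsVec P s -
        qbr (genZ ℂ (2 * (b0 : ℕ) + 2) / genZ ℂ (2 * (b0 : ℕ) + 2 + 1)) *
          ∑ s₀ ∈ univ.filter (fun s₀ => NCState.isolS b0.succ s₀ = s), gsVec P s₀ =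
      qbr (genC ℂ q * genZ ℂ (2 * (b0 : ℕ) + 2) / genZ ℂ (2 * (b0 : ℕ) + 2 + 1)) * genSwap ℂ (2 * (b0 : ℕ) + 2) (gsVec P s) := by
  have hex := h.even b0 (cpOf s)
  have hfib : ipPush (cpIsolate b0.succ) (fun Q => toRF ℂ (P Q)) (cpOf s) =
      ∑ s₀ ∈ univ.filter (fun s₀ => NCState.isolS b0.succ s₀ = s), gsVec P s₀ :=
    sum_fiber_cpIsolate_eq (gs_support hq h) (Fin.succ_ne_zero _) s
  rw [hfib] at hex
  exact hex

end LoopSide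

/-! ### The image of a loop vector under the embedding -/

section EmbVec

/-- **The embedded vector** `(M v)_σ = Σ_s Mc(σ, s) v_s`. [cite: IkhlefPonsaing2012, §3.1] -/
def embVec (q : ℂ) (v : NCState (m + 1) → RapidityField ℂ) (σ : SpinConfig (2 * m + 1)) : RapidityField ℂ :=
  ∑ s, genC ℂ (embMc q σ s) * v s

variable (q) (v : NCState (m + 1) → RapidityField ℂ)

/-- Regrouping a sum along the fibres of a state map. [folklore] -/
theorem sum_mul_sum_fiber (F : NCState (m + 1) → RapidityField ℂ) (G : NCState (m + 1) → NCState (m + 1)) :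
    ∑ s, F s * ∑ s₀ ∈ univ.filter (fun s₀ => G s₀ = s), v s₀ = ∑ s₀, F (G s₀) * v s₀ := by
  classical
  rw [← sum_fiberwise univ G (fun s₀ => F (G s₀) * v s₀)]
  refine sum_congr rfl fun s _ => ?_
  rw [mul_sum]
  refine sum_congr rfl fun s₀ hs₀ => ?_
  rw [(mem_filter.1 hs₀).2]

/-- **The spin-chain generator on the embedded vector is the embedded fibre sum** (join levels).
[cite: IkhlefPonsaing2012, §3.1] -/
theorem spinTL_embVec_join (hq : q ^ 2 + q + 1 = 0) (b : Fin m) (σ : SpinConfig (2 * m + 1)) :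
    spinTL (genC ℂ q) (jL b) (jR b) (embVec q v) σ =
      ∑ s, genC ℂ (embMc q σ s) * ∑ s₀ ∈ univ.filter (fun s₀ => NCState.joinS (Fin.castSucc b) b.succ (by simp) s₀ = s), v s₀ := by
  rw [sum_mul_sum_fiber]
  simp_rw [embMc_joinS hq b σ]
  rw [show spinTL (genC ℂ q) (jL b) (jR b) (embVec q v) σ = if σ (jL b) = σ (jR b) then 0 else
      tlDiag (genC ℂ q) (σ (jL b)) * embVec q v σ + embVec q v (spinFlip (jL b) (jR b) σ) from rfl]
  split_ifs with h
  · simp [genC_zero']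
  · unfold embVec
    rw [mul_sum, ← sum_add_distrib]
    refine sum_congr rfl fun s _ => ?_
    simp only [← cHom_apply]
    rw [map_add, map_mul, show cHom (tlDiag q (σ (jL b))) = tlDiag (cHom q) (σ (jL b)) from genC_tlDiag q _]
    ring

/-- The same at the isolation levels. [cite: IkhlefPonsaing2012, §3.1] -/
theorem spinTL_embVec_isol (hq : q ^ 2 + q + 1 = 0) (b : Fin m) (σ : SpinConfig (2 * m + 1)) :
    spinTL (genC ℂ q) (iL b) (iR b) (embVec q v) σ =
      ∑ s, genC ℂ (embMc q σ s) * ∑ s₀ ∈ univ.filter (fun s₀ => NCState.isolS b.succ s₀ = s), v s₀ := by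
  rw [sum_mul_sum_fiber]
  simp_rw [embMc_isolS hq b σ]
  rw [show spinTL (genC ℂ q) (iL b) (iR b) (embVec q v) σ = if σ (iL b) = σ (iR b) then 0 else
      tlDiag (genC ℂ q) (σ (iL b)) * embVec q v σ + embVec q v (spinFlip (iL b) (iR b) σ) from rfl]
  split_ifs with h
  · simp [genC_zero']
  · unfold embVec
    rw [mul_sum, ← sum_add_distrib]
    refine sum_congr rfl fun s _ => ?_
    simp only [← cHom_apply]
    rw [map_add, map_mul, show cHom (tlDiag q (σ (iL b))) = tlDiag (cHom q) (σ (iL b)) from genC_tlDiag q _]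
    ring

/-- **Transfer of an exchange relation through the embedding.** [folklore] -/
theorem embVec_exchange_of {i : ℕ} {G : NCState (m + 1) → NCState (m + 1)} {sL sR : Fin (2 * m + 1)}
    (hv : ∀ s, qbr (genC ℂ q * genZ ℂ (i + 1) / genZ ℂ i) * v s -
        qbr (genZ ℂ i / genZ ℂ (i + 1)) * ∑ s₀ ∈ univ.filter (fun s₀ => G s₀ = s), v s₀ =
      qbr (genC ℂ q * genZ ℂ i / genZ ℂ (i + 1)) * genSwap ℂ i (v s))
    (σ : SpinConfig (2 * m + 1))
    (hU : spinTL (genC ℂ q) sL sR (embVec q v) σ = ∑ s, genC ℂ (embMc q σ s) * ∑ s₀ ∈ univ.filter (fun s₀ => G s₀ = s), v s₀) :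
    qbr (genC ℂ q * genZ ℂ (i + 1) / genZ ℂ i) * embVec q v σ - qbr (genZ ℂ i / genZ ℂ (i + 1)) * spinTL (genC ℂ q) sL sR (embVec q v) σ =
      qbr (genC ℂ q * genZ ℂ i / genZ ℂ (i + 1)) * genSwap ℂ i (embVec q v σ) := by
  rw [hU]
  unfold embVec
  rw [map_sum, mul_sum, mul_sum, mul_sum, ← sum_sub_distrib]
  refine sum_congr rfl fun s _ => ?_
  rw [map_mul, genSwap_genC]
  have := hv s
  linear_combination (genC ℂ (embMc q σ s)) * this

/-- `ι_k` on the embedded vector. [folklore] -/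
theorem genInv_embVec {k : ℕ} {a : ℤ} (hvk : ∀ s, genInv ℂ k (v s) = genZ ℂ k ^ (2 * a) * v s) (σ : SpinConfig (2 * m + 1)) :
    genInv ℂ k (embVec q v σ) = genZ ℂ k ^ (2 * a) * embVec q v σ := by
  unfold embVec
  rw [map_sum, mul_sum]
  refine sum_congr rfl fun s _ => ?_
  rw [map_mul, genInv_genC, hvk s]; ring

/-- The embedded vector lives on the `m`-sector. [folklore] -/
theorem embVec_of_ne {σ : SpinConfig (2 * m + 1)} (hσ : downCount σ ≠ m) : embVec q v σ = 0 := by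
  unfold embVec
  refine sum_eq_zero fun s _ => ?_
  have : embMc q σ s = 0 := by
    by_contra h; exact hσ (downCount_eq_of_embMc_ne_zero h)
  rw [this, genC_zero', zero_mul]

end EmbVec

/-! ### The exchange relations of the embedded ground state, in vertex form -/

section EmbExchange

variable (hq : q ^ 2 + q + 1 = 0) {P : ColPattern m → MvPolynomial ℕ ℂ} {a : ℤ}
include hq

/-- **`M(P)` satisfies the vertex exchange relations at every adjacent pair.** [cite: IkhlefPonsaing2012, §3.1, §3.4] -/
theorem embVec_gs_exchange (h : IsGroundState m q P a) (s t : Fin (2 * m + 1)) (hst : t.val = s.val + 1)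
    (σ : SpinConfig (2 * m + 1)) :
    qbr (genC ℂ q * zv t / zv s) * embVec q (gsVec P) σ - qbr (zv s / zv t) * spinTL (genC ℂ q) s t (embVec q (gsVec P)) σ =
      qbr (genC ℂ q * zv s / zv t) * genSwap ℂ (s.val + 1) (embVec q (gsVec P) σ) := by
  have ht := t.isLt
  obtain ⟨j, hj | hj⟩ := Nat.even_or_odd' s.val
  · -- join level `2j+1`
    have hjm : j < m := by omega
    have hs : s = jL ⟨j, hjm⟩ := Fin.ext (by simp [jL]; omega)
    have ht' : t = jR ⟨j, hjm⟩ := Fin.ext (by simp [jR]; omega)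
    subst hs; subst ht'
    have e1 : zv (jL (⟨j, hjm⟩ : Fin m)) = genZ ℂ (2 * j + 1) := by unfold zv jL; rfl
    have e2 : zv (jR (⟨j, hjm⟩ : Fin m)) = genZ ℂ (2 * j + 1 + 1) := by unfold zv jR; rfl
    have e3 : (jL (⟨j, hjm⟩ : Fin m)).val + 1 = 2 * j + 1 := by simp [jL]
    rw [e1, e2, e3]
    exact embVec_exchange_of q (gsVec P) (fun s' => gsVec_exchange_join hq h ⟨j, hjm⟩ s') σ
      (spinTL_embVec_join q (gsVec P) hq ⟨j, hjm⟩ σ)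
  · -- isolation level `2j+2`
    have hjm : j < m := by omega
    have hs : s = iL ⟨j, hjm⟩ := Fin.ext (by simp [iL]; omega)
    have ht' : t = iR ⟨j, hjm⟩ := Fin.ext (by simp [iR]; omega)
    subst hs; subst ht'
    have e1 : zv (iL (⟨j, hjm⟩ : Fin m)) = genZ ℂ (2 * j + 2) := by unfold zv iL; rfl
    have e2 : zv (iR (⟨j, hjm⟩ : Fin m)) = genZ ℂ (2 * j + 2 + 1) := by unfold zv iR; rfl
    have e3 : (iL (⟨j, hjm⟩ : Fin m)).val + 1 = 2 * j + 2 := by simp [iL]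
    rw [e1, e2, e3]
    exact embVec_exchange_of q (gsVec P) (fun s' => gsVec_exchange_isol hq h ⟨j, hjm⟩ s') σ
      (spinTL_embVec_isol q (gsVec P) hq ⟨j, hjm⟩ σ)

end EmbExchange

/-! ### The twisted vertex solution -/

section Twisted

/-- `ι_1 Π = z_1^{-2} Π`. [folklore] -/
theorem genInv_one_zvProd {L : ℕ} (hL : 1 ≤ L) : genInv ℂ 1 (zvProd L) = (zv (⟨0, by omega⟩ : Fin L) ^ 2)⁻¹ * zvProd L := by
  have h := genInv_one_zvProd_inv hL
  rw [map_inv₀] at h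
  have h0 : zv (⟨0, by omega⟩ : Fin L) ≠ 0 := zv_ne_zero _
  have hP := zvProd_ne_zero L
  have : genInv ℂ 1 (zvProd L) = ((zvProd L)⁻¹ * zv (⟨0, by omega⟩ : Fin L) ^ 2)⁻¹ := by
    rw [mul_comm, ← h, inv_inv]
  rw [this, mul_inv, inv_inv, mul_comm]

/-- `ι_L Π = z_L^{-2} Π`. [folklore] -/
theorem genInv_last_zvProd (L' : ℕ) :
    genInv ℂ (L' + 1) (zvProd (L' + 1)) = (zv (Fin.last L') ^ 2)⁻¹ * zvProd (L' + 1) := by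
  have h0 : zv (Fin.last L') ≠ 0 := zv_ne_zero _
  unfold zvProd
  rw [map_prod, ← mul_prod_erase univ _ (mem_univ (Fin.last L')), ← mul_prod_erase univ (fun j => zv j) (mem_univ (Fin.last L'))]
  have hfix : ∀ j ∈ univ.erase (Fin.last L'), genInv ℂ (L' + 1) (zv j) = zv j := fun j hj => by
    refine genInv_zv_of_ne' fun h => ne_of_mem_erase hj (Fin.ext ?_)
    simp; omega
  rw [prod_congr rfl hfix, genInv_zv_self' (k := L' + 1) (j := Fin.last L') (by simp)]
  field_simp

/-- The generator is linear over scalars (pointwise constant factor). [folklore] -/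
theorem spinTL_const_mul {L : ℕ} (c x : RapidityField ℂ) (s t : Fin L) (f : SpinConfig L → RapidityField ℂ) (σ : SpinConfig L) :
    spinTL c s t (fun τ => x * f τ) σ = x * spinTL c s t f σ := by
  unfold spinTL; split_ifs <;> ring

variable (hq : q ^ 2 + q + 1 = 0)
include hq

/-- **The twisted vertex solution** `Π^e Φ` solves the vertex system with twist `-e`. [cite: HagendorfLienardy2021, §3] -/
theorem twisted_exchange (e : ℕ) (s t : Fin (2 * m + 1)) (hst : t.val = s.val + 1) (σ : SpinConfig (2 * m + 1)) :
    qbr (genC ℂ q * zv t / zv s) * (zvProd (2 * m + 1) ^ e * oursVec q (2 * m + 1) m σ) -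
        qbr (zv s / zv t) * spinTL (genC ℂ q) s t (fun τ => zvProd (2 * m + 1) ^ e * oursVec q (2 * m + 1) m τ) σ =
      qbr (genC ℂ q * zv s / zv t) * genSwap ℂ (s.val + 1) (zvProd (2 * m + 1) ^ e * oursVec q (2 * m + 1) m σ) := by
  rw [spinTL_const_mul, map_mul, map_pow, genSwap_zvProd hst]
  have := ours_exchange (L := 2 * m + 1) (n := m) hq hst σ
  linear_combination zvProd (2 * m + 1) ^ e * this

/-- Bottom reflection of the twisted solution (`m = n+1 ≥ 1`). [cite: HagendorfLienardy2021, Prop. 3.8] -/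
theorem twisted_bot {n : ℕ} (e : ℕ) (σ : SpinConfig (2 * (n + 1) + 1)) :
    genInv ℂ 1 (zvProd (2 * (n + 1) + 1) ^ e * oursVec q (2 * (n + 1) + 1) (n + 1) σ) =
      genZ ℂ 1 ^ (2 * (-(e : ℤ))) * (zvProd (2 * (n + 1) + 1) ^ e * oursVec q (2 * (n + 1) + 1) (n + 1) σ) := by
  rw [map_mul, map_pow, genInv_one_zvProd (by omega), genInv_one_oursVec hq (by omega) (by omega) (by omega) σ]
  have e0 : zv (⟨0, by omega⟩ : Fin (2 * (n + 1) + 1)) = genZ ℂ 1 := rfl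
  rw [e0, mul_pow, ← inv_pow, ← pow_mul, show (2 * -(e : ℤ)) = -((2 * e : ℕ) : ℤ) by push_cast; ring, zpow_neg, zpow_natCast]
  ring

/-- Top reflection of the twisted solution. [cite: HagendorfLienardy2021, Prop. 3.7] -/
theorem twisted_top {n : ℕ} (e : ℕ) (σ : SpinConfig (2 * (n + 1) + 1)) :
    genInv ℂ (2 * (n + 1) + 1) (zvProd (2 * (n + 1) + 1) ^ e * oursVec q (2 * (n + 1) + 1) (n + 1) σ) =
      genZ ℂ (2 * (n + 1) + 1) ^ (2 * (-(e : ℤ))) * (zvProd (2 * (n + 1) + 1) ^ e * oursVec q (2 * (n + 1) + 1) (n + 1) σ) := by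
  rw [map_mul, map_pow, genInv_last_zvProd, genInv_last_oursVec (L' := 2 * (n + 1)) (n' := n) hq (by omega) (by omega) σ]
  have e0 : zv (Fin.last (2 * (n + 1))) = genZ ℂ (2 * (n + 1) + 1) := rfl
  rw [e0, mul_pow, ← inv_pow, ← pow_mul, show (2 * -(e : ℤ)) = -((2 * e : ℕ) : ℤ) by push_cast; ring, zpow_neg, zpow_natCast]
  ring

/-- **The Laurent polynomial components**: `Π^{2m} Φ_σ = G_σ` with `deg_{z_1} G_σ ≤ 4m` (`m = n+1`).
[cite: HagendorfLienardy2021, Prop. 3.10] -/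
theorem exists_poly_components {n : ℕ} (σ : SpinConfig (2 * (n + 1) + 1)) :
    ∃ G : MvPolynomial ℕ ℂ, zvProd (2 * (n + 1) + 1) ^ (2 * (n + 1)) * oursVec q (2 * (n + 1) + 1) (n + 1) σ = toRF ℂ G ∧
      G.degreeOf 1 ≤ 4 * (n + 1) := by
  obtain ⟨F, hF⟩ := oursVec_laurent (L := 2 * (n + 1) + 1) (n := n + 1) (k := n + 1) hq (by omega) (by omega) (by omega) σ
  refine ⟨MvPolynomial.expand 2 F, hF, ?_⟩
  refine degreeOf_le_of_genInv_mul_pow (K₀ := ℂ) ?_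
  have eF : toRF ℂ (MvPolynomial.expand 2 F) = toRF2 F := rfl
  rw [eF, ← hF, map_mul, map_pow, genInv_one_zvProd (by omega), genInv_one_oursVec hq (by omega) (by omega) (by omega) σ]
  have e0 : zv (⟨0, by omega⟩ : Fin (2 * (n + 1) + 1)) = genZ ℂ 1 := rfl
  rw [e0]
  have hz : genZ ℂ 1 ≠ 0 := genZ_ne_zero 1
  rw [mul_pow, inv_pow, ← pow_mul, show 2 * (2 * (n + 1)) = 4 * (n + 1) by ring]
  field_simp

end Twisted

/-! ### Degrees of sums -/

/-- The degree of a finite sum is bounded by a common bound of the summands. [folklore] -/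
theorem degreeOf_sum_le_of_forall {ι : Type*} (S : Finset ι) (f : ι → MvPolynomial ℕ ℂ) {k D : ℕ}
    (h : ∀ i ∈ S, (f i).degreeOf k ≤ D) : (∑ i ∈ S, f i).degreeOf k ≤ D := by
  classical
  induction S using Finset.induction_on with
  | empty => simp
  | insert i S hi ih =>
    rw [sum_insert hi]
    exact (degreeOf_add_le _ _ _).trans (max_le (h i (mem_insert_self _ _)) (ih fun j hj => h j (mem_insert_of_mem hj)))

/-! ### The twist bound and IP12 Prop. 4.7 -/

namespace IsGroundState

variable {n : ℕ} {P : ColPattern (n + 1) → MvPolynomial ℕ ℂ} {a : ℤ}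

/-- **The twist bound `-a ≤ 2m` from the vertex solution** (`m = n+1`). [cite: IkhlefPonsaing2012, §3.5–3.6] -/
theorem neg_twist_le_vertex (hq : q ^ 2 + q + 1 = 0) (h : IsGroundState (n + 1) q P a) : -a ≤ 2 * (n + 1) := by
  classical
  -- `a ≤ 0`
  obtain ⟨Q₀, hQ₀⟩ := h.prim.exists_ne_zero
  have ha0 : a ≤ 0 := by have := twist_nonpos hQ₀ (h.bot Q₀); omega
  obtain ⟨e, he⟩ : ∃ e : ℕ, (e : ℤ) = -a := ⟨(-a).toNat, Int.toNat_of_nonneg (by omega)⟩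
  -- the two vertex solutions
  set L := 2 * (n + 1) + 1 with hL
  set v : NCState (n + 1 + 1) → RapidityField ℂ := gsVec P with hv
  set ΦM : SpinConfig L → RapidityField ℂ := embVec q v with hΦM
  set Φ' : SpinConfig L → RapidityField ℂ := fun σ => zvProd L ^ e * oursVec q L (n + 1) σ with hΦ'
  set σ₀ : SpinConfig L := packed L (n + 1) with hσ₀
  have hbotv : ∀ s, genInv ℂ 1 (v s) = genZ ℂ 1 ^ (2 * a) * v s := fun s => h.bot (cpOf s)
  have htopv : ∀ s, genInv ℂ (2 * (n + 1) + 1) (v s) = genZ ℂ (2 * (n + 1) + 1) ^ (2 * a) * v s := fun s => h.top (cpOf s)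
  have hae : (2 * a : ℤ) = 2 * (-(e : ℤ)) := by omega
  have prop : ∀ σ, Φ' σ₀ * ΦM σ = ΦM σ₀ * Φ' σ := fun σ =>
    vertex_solutions_proportional hq (Φ := ΦM) (Φ' := Φ') (a := a)
      (fun σ hσ => embVec_of_ne q v hσ) (fun s t hst σ => embVec_gs_exchange hq h s t hst σ)
      (fun σ => genInv_embVec q v hbotv σ) (fun σ => genInv_embVec q v htopv σ)
      (fun σ hσ => by simp only [hΦ']; rw [oursVec_of_ne q hσ, mul_zero])
      (fun s t hst σ => twisted_exchange hq e s t hst σ)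
      (fun σ => by rw [hae]; exact twisted_bot hq e σ) (fun σ => by rw [hae]; exact twisted_top hq e σ) σ₀ σ
  have hd₀ : Φ' σ₀ ≠ 0 := mul_ne_zero (pow_ne_zero _ (zvProd_ne_zero _)) (oursVec_packed_ne_zero hq (by omega))
  -- the polynomial components of `Π^{2m} Φ`
  have hG := fun σ : SpinConfig L => exists_poly_components hq (n := n) σ
  choose G hG1 hG2 using hG
  -- the left inverse of the embedding
  obtain ⟨N, hN⟩ := exists_leftInverse_embMc hq (m := n + 1)
  have hNv : ∀ s, ∑ σ, genC ℂ (N s σ) * ΦM σ = v s := by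
    intro s
    have e1 : ∑ σ, genC ℂ (N s σ) * ΦM σ = ∑ s', cHom (∑ σ, N s σ * embMc q σ s') * v s' := by
      simp only [hΦM, embVec, mul_sum, map_sum, sum_mul]
      rw [sum_comm]
      refine sum_congr rfl fun s' _ => sum_congr rfl fun σ _ => ?_
      rw [map_mul, cHom_apply, cHom_apply]; ring
    rw [e1, sum_eq_single s]
    · rw [hN s s, if_pos rfl, map_one, one_mul]
    · intro s' _ hs'; rw [hN s s', if_neg (Ne.symm hs'), map_zero, zero_mul]
    · intro h'; exact absurd (mem_univ s) h'
  -- `ΦM σ₀ ≠ 0`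
  have hc₀ : ΦM σ₀ ≠ 0 := by
    intro h0
    have hall : ∀ σ, ΦM σ = 0 := fun σ => by
      have := prop σ; rw [h0, zero_mul] at this
      exact (mul_eq_zero.1 this).resolve_left hd₀
    have hv0 : ∀ s, v s = 0 := fun s => by rw [← hNv s]; exact sum_eq_zero fun σ _ => by rw [hall σ, mul_zero]
    apply hQ₀
    by_contra hne
    have hmem := groundState_support hq h.fixed (Q := Q₀) (fun h' => hne (toRF_injective (h'.trans (map_zero _).symm)))
    obtain ⟨s, hs⟩ := exists_cpOf_eq hmem
    have := hv0 s
    simp only [hv, gsVec, hs] at this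
    exact hne (toRF_injective (this.trans (map_zero _).symm))
  -- `v_s = μ · H_s`
  set H : NCState (n + 1 + 1) → MvPolynomial ℕ ℂ := fun s => ∑ σ, C (N s σ) * G σ with hH
  have hdegH : ∀ s, (H s).degreeOf 1 ≤ 4 * (n + 1) := fun s =>
    degreeOf_sum_le_of_forall _ _ fun σ _ => (degreeOf_C_mul_le _ _ _).trans (hG2 σ)
  set Pm : RapidityField ℂ := zvProd L ^ (2 * (n + 1)) with hPm
  have hPm0 : Pm ≠ 0 := pow_ne_zero _ (zvProd_ne_zero _)
  set μ : RapidityField ℂ := ΦM σ₀ * zvProd L ^ e / (Φ' σ₀ * Pm) with hμ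
  have hμ0 : μ ≠ 0 := div_ne_zero (mul_ne_zero hc₀ (pow_ne_zero _ (zvProd_ne_zero _))) (mul_ne_zero hd₀ hPm0)
  have hvH : ∀ s, v s = μ * toRF ℂ (H s) := by
    intro s
    have e1 : Φ' σ₀ * Pm * v s = ΦM σ₀ * zvProd L ^ e * toRF ℂ (H s) := by
      rw [← hNv s, mul_sum, hH]
      simp only [map_sum, map_mul]
      rw [mul_sum]
      refine sum_congr rfl fun σ _ => ?_
      have := prop σ
      rw [show toRF ℂ (C (N s σ)) = genC ℂ (N s σ) from rfl, ← hG1 σ]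
      simp only [hΦ'] at this ⊢
      linear_combination (Pm * genC ℂ (N s σ)) * this
    rw [hμ, div_mul_eq_mul_div, eq_div_iff (mul_ne_zero hd₀ hPm0)]
    linear_combination e1
  -- primitivity of `s ↦ P_{Q_s}` makes `μ⁻¹` a polynomial
  have hprim' : PolyPrimitive (fun s : NCState (n + 1 + 1) => P (cpOf s)) := by
    intro d hd
    refine h.prim d fun Q => ?_
    by_cases hQ : P Q = 0
    · rw [hQ]; exact dvd_zero d
    · have hmem := groundState_support hq h.fixed (Q := Q) (fun h' => hQ (toRF_injective (h'.trans (map_zero _).symm)))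
      obtain ⟨s, hs⟩ := exists_cpOf_eq hmem
      rw [← hs]; exact hd s
  obtain ⟨B, hB⟩ := hprim'.exists_eq_toRF (c := μ⁻¹) fun s => ⟨H s, by
    show μ⁻¹ * toRF ℂ (P (cpOf s)) = toRF ℂ (H s)
    rw [show toRF ℂ (P (cpOf s)) = v s from rfl, hvH s, ← mul_assoc, inv_mul_cancel₀ hμ0, one_mul]⟩
  have hHB : ∀ s, H s = B * P (cpOf s) := fun s => toRF_injective (by
    rw [map_mul, ← hB, show toRF ℂ (P (cpOf s)) = v s from rfl, hvH s, ← mul_assoc, inv_mul_cancel₀ hμ0, one_mul])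
  have hB0 : B ≠ 0 := by
    rintro rfl
    rw [map_zero] at hB
    exact inv_ne_zero hμ0 hB
  -- a component not divisible by `X_1`
  obtain ⟨Q₁, hQ₁⟩ : ∃ Q₁, substHom 1 0 (P Q₁) ≠ 0 := by
    by_contra hall
    push Not at hall
    have hdvd : ∀ Q, (X 1 : MvPolynomial ℕ ℂ) ∣ P Q := fun Q => by
      simpa using X_sub_dvd_of_substHom_eq_zero (hall Q)
    obtain ⟨r, -, hr⟩ := MvPolynomial.isUnit_iff_eq_C_of_isReduced.1 (h.prim (X 1) hdvd)
    have := congrArg (degreeOf 1) hr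
    rw [degreeOf_C, degreeOf_X, if_pos rfl] at this
    exact one_ne_zero this
  have hP₁ : P Q₁ ≠ 0 := fun h0 => hQ₁ (by rw [h0, map_zero])
  obtain ⟨s₁, hs₁⟩ := exists_cpOf_eq (groundState_support hq h.fixed (Q := Q₁)
    (fun h' => hP₁ (toRF_injective (h'.trans (map_zero _).symm))))
  -- its `z_1`-degree is `-2a ≤ deg H ≤ 4m`
  set D := (2 * (-a)).toNat with hD
  have hbotpow : genInv ℂ 1 (toRF ℂ (P Q₁)) * genZ ℂ 1 ^ D = toRF ℂ (P Q₁) := by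
    rw [h.bot Q₁, mul_assoc, mul_comm (toRF ℂ (P Q₁)), ← mul_assoc, ← zpow_natCast, ← zpow_add₀ (genZ_ne_zero 1),
      hD, Int.toNat_of_nonneg (by omega)]
    have : (2 * a + 2 * -a : ℤ) = 0 := by ring
    rw [this, zpow_zero, one_mul]
  have hdeg₁ : (P Q₁).degreeOf 1 ≤ D := degreeOf_le_of_genInv_mul_pow hbotpow
  have htopcoef : uCoeff ℂ 1 D (P Q₁) ≠ 0 := by
    rw [uCoeff_top_eq_substHom_of_revPoly hdeg₁ (revPoly_eq_self_of_genInv hdeg₁ hbotpow)]; exact hQ₁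
  have hDle : D ≤ (P Q₁).degreeOf 1 := by
    by_contra hlt; rw [not_le] at hlt; exact htopcoef (uCoeff_eq_zero_of_lt hlt)
  have hdegP : (P Q₁).degreeOf 1 ≤ (H s₁).degreeOf 1 := by
    rw [hHB s₁, hs₁, degreeOf_eq_natDegree_rapUni 1 (P Q₁), degreeOf_eq_natDegree_rapUni 1 (B * P Q₁), map_mul,
      Polynomial.natDegree_mul ((map_ne_zero_iff _ (rapUni_injective 1)).2 hB0) ((map_ne_zero_iff _ (rapUni_injective 1)).2 hP₁)]
    exact Nat.le_add_left _ _
  have : D ≤ 4 * (n + 1) := hDle.trans (hdegP.trans (hdegH s₁))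
  rw [hD] at this
  omega

/-- **`GroundStateBounds` unconditionally.** [cite: IkhlefPonsaing2012, §3.4–4.1] -/
theorem bounds_vertex (hq : q ^ 2 + q + 1 = 0) (h : IsGroundState (n + 1) q P a) : GroundStateBounds (n + 1) P := by
  classical
  have ha := h.neg_twist_le_vertex hq
  refine ⟨fun s hs => ?_, h.wfree hq, fun Q Q' hJ => h.vanish hq (Nat.succ_ne_zero n) Q Q' hJ⟩
  obtain ⟨Q, -, hsQ⟩ := Finset.mem_biUnion.1 (support_sum hs)
  have hrel := h.pair_rel hq Q hsQ
  have : (2 * (-a)).toNat ≤ 4 * (n + 1) := by omega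
  omega

end IsGroundState

/-- **IP12 Proposition 4.7** (the finite-size left-passage probability formula): discharged.
[cite: IkhlefPonsaing2012, Prop. 4.7] -/
theorem IkhlefPonsaingFirstPassage_holds : IkhlefPonsaingFirstPassage := by
  obtain ⟨q, hq⟩ := exists_quad_root
  exact ikhlefPonsaingFirstPassage_of_bounds hq fun k P a h => h.bounds_vertex hq

end Literature.Probability.Percolation
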